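import Literature.NumberTheory.Automorphic.Liu2021.Def411WeilCarriersIrreducibleOfLemD1
import Literature.NumberTheory.Automorphic.UnitaryGroupNonsplitPlace
import Literature.RepresentationTheory.TwistedCoinvariantsCompactEigenvector
import HarnessLib

/-!
# Survival of the unramified vector `1_{𝒪_vⁿ}` in the central `χ_v`-coinvariants at the NON-SPLIT places

Topic `NumberTheory/Automorphic`; namespaces `Literature.NumberTheory.Automorphic.UnitaryGroup` (§1, the local
torus `U(J₁)(F_v) = E_v¹` at a non-split place) and
`Literature.NumberTheory.GelbartRogawski1991.UnitaryDualPair.LocalSplitting.FinLocalSplittings` (§2, dot-notation on the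
tree's structure of local splittings).  KERNEL ONLY: theorems, 0 definitions, 0 records, 0 named facts, 0 sorry.

[Liu2021, Def. 4.11 (FJcycle.tex l. 2092–2096)] defines `ω(μ, ε, χ) := ⊗'_v ω(μ_v, ε_v, χ_v)`, the restricted tensor
product of the LOCAL maximal quotients on which the centre `E_v¹` acts by `χ_v`; writing `⊗'` presupposes that for
almost all `v` the image of the unramified vector `1_{𝒪_vⁿ}` in the local quotient is NON-ZERO («survival»).  In the
tree this is the hypothesis `hS : ∃ S₁, ∀ v ∉ S₁, TwistedCoinv.mk (𝓢.omegaLoc v ∘ localCenter …) χ_{1,v} (unitVec F (Fin N) v) ≠ 0`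
of `Def411WeilCarriers.rho_isIrreducible_of_irreducibleAdmissible_local[_adapted]` /
`rho_isIrreducible_of_lemD1AsPrinted_of_factors` (the residual (ρ3) of the `hirr ↦ hD1` junction).  This file PROVES
it at the NON-SPLIT places (`v` inert or ramified in `E/F`):

* §1 **`UnitaryGroup.localInt_one_eq_top_of_smul_eq`** — at a non-split place (`c • w = w` for the place `w ∣ v`)
  the whole local torus `U(J₁)(F_v)` of a hermitian LINE `J₁ = (j)` is integral: `U(J₁)(𝒪_v) = U(J₁)(F_v)` (a
  norm-one element `c_*(a) a = 1` of the local FIELD `E_w` has valuation `1`, `valued_galAdicCompletionMap`); hence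
  **`compactSpace_localPi_one_of_smul_eq`**: `U(J₁)(F_v) = E_v¹` is COMPACT; and `continuous_localCenter`
  (the centre `u ↦ u · 1_N : U(J₁)(F_v) → U(J)(F_v)` is continuous);
* §2 **`FinLocalSplittings.eventually_mk_unitVec_ne_zero_of_nonsplit`** — for a family `𝓢` of local splittings of
  `U(J)(F_v)` (tree `FiniteAdelicSplittingAssembly`) and a continuous character `χ₁` of the centre `E¹(𝔸_{F,f})`:
  for all but finitely many `v`, IF `v` is non-split THEN the class of `1_{𝒪_vᴺ}` in the `χ_{1,v}`-coinvariants of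
  `ω_v ∘ (local centre)` is non-zero.  Proof: off a finite set, `U(J)(𝒪_v)` fixes `1_{𝒪_vᴺ}` (`𝓢.unramified`) and
  `χ_{1,v}` is trivial on `U(J₁)(𝒪_v)` (`eventually_localCharOfCenter_eq_one`, [TateThesis1967, Lemma 3.2.1]); at a
  non-split `v`, `U(J₁)(𝒪_v)` is ALL of the compact `E_v¹` (§1), so `1_{𝒪_vᴺ}` is an invariant vector of a compact
  group acting smoothly with trivial `χ_{1,v}` and survives by `TwistedCoinv.mk_ne_zero_of_mem_invariants`
  (`TwistedCoinvariantsCompactEigenvector`); the `Finset` form `exists_finset_mk_unitVec_ne_zero_of_nonsplit`.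

What is NOT here (the honest residual): the SPLIT places, where `E_v¹ ≅ F_vˣ` is NOT compact and survival is a
genuine statement about the local Weil representation (the centre acts through a dilation-type operator; [Liu2021,
proof of Lem. D.1, l. 5241–5245]: `ω ≅` a unitary induction from `Q_{n-1,1}`); the `∃ S₁, ∀ v ∉ S₁` clause `hS` over
ALL places therefore remains displayed until the split case lands.

## References
* [Liu2021] Y. Liu, Camb. J. Math. 9 (2021) = arXiv:2102.11518, Def. 4.11 (l. 2092–2096), App. D Step 3 (l. 5221),
  Lem. D.1 (l. 5227, proof l. 5241–5245).
* [TateThesis1967] J. Tate, in Cassels–Fröhlich (1967), §3.2 Lemma 3.2.1.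
* [BernsteinZelevinsky1976] I. N. Bernstein, A. V. Zelevinsky, Russian Math. Surveys 31 (1976), §2.3.
* [PlatonovRapinchuk1994] V. Platonov, A. Rapinchuk (1994), §5.1 (`G_{𝒪_v}`), §6.2 (the norm-one torus).
* [CasselsFrohlichANT1967] Ch. VII Prop. 1.2 (ii) (places of `E` above a non-split `v`).
-/

set_option autoImplicit false

noncomputable section

open scoped Matrix
open NumberField IsDedekindDomain Filter Set
open Literature.NumberTheory.Automorphic Literature.NumberTheory.Automorphic.UnitaryGroup
open Literature.NumberTheory.Weil1964 Literature.RepresentationTheory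
open Literature.RepresentationTheory.HeisenbergGroup

/-! ## §1 The local torus `U(J₁)(F_v) = E_v¹` at a non-split place: integral, compact -/

namespace Literature.NumberTheory.Automorphic.UnitaryGroup

section Nonsplit

variable {F E : Type} [Field F] [NumberField F] [Field E] [NumberField E] [Algebra F E]
variable (c : E ≃ₐ[F] E) (J₁ : Matrix (Fin 1) (Fin 1) E)

/-- in a linearly ordered commutative monoid with zero, `x * x = 1` forces `x = 1` (private arithmetic step).
[folklore] -/
private theorem eq_one_of_mul_self_eq_one {Γ : Type*} [LinearOrderedCommMonoidWithZero Γ] {x : Γ} (hx : x * x = 1) :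
    x = 1 := by
  rcases lt_trichotomy x 1 with hlt | heq | hgt
  · have h : x * x ≤ x * 1 := mul_le_mul' le_rfl hlt.le
    rw [mul_one, hx] at h
    exact absurd hlt (not_lt.2 h)
  · exact heq
  · have h : x * 1 ≤ x * x := mul_le_mul' le_rfl hgt.le
    rw [mul_one, hx] at h
    exact absurd hgt (not_lt.2 h)

/-- **a norm-one element of the local torus at a NON-SPLIT place has valuation `1`**: for `g ∈ U(J₁)(F_v)`, `J₁ = (j)`,
`j ≠ 0`, and `c • w = w` for the place `w ∣ v`, the entry `a = (g_{w'})₀₀ ∈ E_{w'}` satisfies `v_{w'}(a) = 1`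
(`c_*(a) · a = 1` by `galMap_entry_mul_entry_eq_one`, `v(c_* a) = v(a)` by `valued_galAdicCompletionMap`, and `w' = w`
is the only place above `v`). [cite: PlatonovRapinchuk1994, §6.2] -/
theorem valued_entry_eq_one_of_smul_eq [Algebra.IsQuadraticExtension F E] (hc : c ≠ 1) (hJ₁ : J₁ 0 0 ≠ 0)
    {v : HeightOneSpectrum (𝓞 F)} (w : PlacesOver E v) (hw : c • w.1 = w.1) (g : localPi E c 1 J₁ v)
    (w' : PlacesOver E v) :
    Valued.v ((((g : LocalGLPi E 1 v) w' : GL (Fin 1) (w'.1.adicCompletion E)) :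
      Matrix (Fin 1) (Fin 1) (w'.1.adicCompletion E)) 0 0) = 1 := by
  haveI := PlacesOver.subsingleton_of_smul_eq c hc w hw
  have h := congrArg Valued.v (galMap_entry_mul_entry_eq_one E c J₁ hJ₁ v g w')
  rw [map_mul, map_one, valued_galAdicCompletionMap] at h
  -- the two entries sit at the same place (`PlacesOver E v` is a subsingleton): compare their valuations in `ℤᵐ⁰`
  have heq : Valued.v ((((g : LocalGLPi E 1 v) (PlacesOver.galInv c w') :
        GL (Fin 1) ((PlacesOver.galInv c w').1.adicCompletion E)) :
          Matrix (Fin 1) (Fin 1) ((PlacesOver.galInv c w').1.adicCompletion E)) 0 0) =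
      Valued.v ((((g : LocalGLPi E 1 v) w' : GL (Fin 1) (w'.1.adicCompletion E)) :
        Matrix (Fin 1) (Fin 1) (w'.1.adicCompletion E)) 0 0) :=
    congrArg (fun w'' : PlacesOver E v => Valued.v ((((g : LocalGLPi E 1 v) w'' : GL (Fin 1) (w''.1.adicCompletion E)) :
      Matrix (Fin 1) (Fin 1) (w''.1.adicCompletion E)) 0 0)) (Subsingleton.elim _ _)
  rw [heq] at h
  exact eq_one_of_mul_self_eq_one h

/-- valuation `≤ 1` means membership in the valuation ring `𝒪[E_w]` of the tree's `glInt` (private bridge between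
Mathlib's `Valued.v` and the `ValuativeRel` integers). [folklore] -/
private theorem mem_integer_of_valued_le_one {w : HeightOneSpectrum (𝓞 E)} {x : w.adicCompletion E}
    (hx : Valued.v x ≤ 1) : x ∈ (ValuativeRel.valuation (w.adicCompletion E)).integer :=
  (Valuation.mem_integer_iff _ _).2
    ((Valuation.vle_one_iff (ValuativeRel.valuation (w.adicCompletion E))).1 ((Valuation.vle_one_iff Valued.v).2 hx))

/-- **at a non-split place the local torus of a line is integral**: `U(J₁)(F_v) ≤ U(J₁)(𝒪_v)`, i.e. every element of
`E_v¹` is a unit of `𝒪_{E_w}` together with its inverse. [cite: PlatonovRapinchuk1994, §6.2] -/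
theorem mem_localInt_one_of_smul_eq [Algebra.IsQuadraticExtension F E] (hc : c ≠ 1) (hJ₁ : J₁ 0 0 ≠ 0)
    {v : HeightOneSpectrum (𝓞 F)} (w : PlacesOver E v) (hw : c • w.1 = w.1) (g : localPi E c 1 J₁ v) :
    g ∈ localInt E c 1 J₁ v := by
  rw [mem_localInt_iff]
  intro w'
  rw [mem_glInt_iff]
  set a : w'.1.adicCompletion E := (((g : LocalGLPi E 1 v) w' : GL (Fin 1) (w'.1.adicCompletion E)) :
    Matrix (Fin 1) (Fin 1) (w'.1.adicCompletion E)) 0 0 with ha_def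
  set b : w'.1.adicCompletion E := ((((g : LocalGLPi E 1 v) w')⁻¹ : GL (Fin 1) (w'.1.adicCompletion E)) :
    Matrix (Fin 1) (Fin 1) (w'.1.adicCompletion E)) 0 0 with hb_def
  have ha : Valued.v a = 1 := valued_entry_eq_one_of_smul_eq c J₁ hc hJ₁ w hw g w'
  -- the inverse entry: `b * a = 1`
  have hba : b * a = 1 := by
    have hmat : ((((g : LocalGLPi E 1 v) w')⁻¹ : GL (Fin 1) (w'.1.adicCompletion E)) :
        Matrix (Fin 1) (Fin 1) (w'.1.adicCompletion E)) *
        (((g : LocalGLPi E 1 v) w' : GL (Fin 1) (w'.1.adicCompletion E)) : Matrix (Fin 1) (Fin 1) (w'.1.adicCompletion E)) = 1 := by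
      rw [← Units.val_mul, inv_mul_cancel, Units.val_one]
    have h00 := congrFun (congrFun hmat 0) 0
    rw [Matrix.mul_apply, Fin.sum_univ_one, Matrix.one_apply_eq] at h00
    exact h00
  have hb : Valued.v b = 1 := by
    have h := congrArg Valued.v hba
    rw [map_mul, ha, mul_one, map_one] at h
    exact h
  refine ⟨fun i j => ?_, fun i j => ?_⟩
  · fin_cases i; fin_cases j
    exact mem_integer_of_valued_le_one ha.le
  · fin_cases i; fin_cases j
    exact mem_integer_of_valued_le_one hb.le

/-- **`U(J₁)(𝒪_v) = U(J₁)(F_v)` at a non-split place.** [cite: PlatonovRapinchuk1994, §6.2] -/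
theorem localInt_one_eq_top_of_smul_eq [Algebra.IsQuadraticExtension F E] (hc : c ≠ 1) (hJ₁ : J₁ 0 0 ≠ 0)
    {v : HeightOneSpectrum (𝓞 F)} (w : PlacesOver E v) (hw : c • w.1 = w.1) : localInt E c 1 J₁ v = ⊤ :=
  eq_top_iff.2 fun g _ => mem_localInt_one_of_smul_eq c J₁ hc hJ₁ w hw g

/-- **the local torus `U(J₁)(F_v) = E_v¹` is COMPACT at a non-split place** (it is its own integral subgroup
`U(J₁)(𝒪_v)`, compact by `isCompact_localInt`). [cite: PlatonovRapinchuk1994, §6.2] -/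
theorem compactSpace_localPi_one_of_smul_eq [Algebra.IsQuadraticExtension F E] (hc : c ≠ 1) (hJ₁ : J₁ 0 0 ≠ 0)
    {v : HeightOneSpectrum (𝓞 F)} (w : PlacesOver E v) (hw : c • w.1 = w.1) : CompactSpace (localPi E c 1 J₁ v) := by
  refine ⟨?_⟩
  have h := isCompact_localInt E c 1 J₁ v
  rwa [localInt_one_eq_top_of_smul_eq c J₁ hc hJ₁ w hw, Subgroup.coe_top] at h

end Nonsplit

section Continuity

variable {F : Type} [Field F] [NumberField F] (E : Type) [Field E] [NumberField E] [Algebra F E]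
variable (c : E ≃ₐ[F] E) (N : ℕ) (J : Matrix (Fin N) (Fin N) E) (J₁ : Matrix (Fin 1) (Fin 1) E)

omit [NumberField F] in
/-- `a ↦ a · 1_N : E_w → M_N(E_w)` is continuous. [folklore] -/
private theorem continuous_scalar (w : HeightOneSpectrum (𝓞 E)) :
    Continuous (Matrix.scalar (Fin N) : w.adicCompletion E → Matrix (Fin N) (Fin N) (w.adicCompletion E)) := by
  have h : (Matrix.scalar (Fin N) : w.adicCompletion E → Matrix (Fin N) (Fin N) (w.adicCompletion E)) =
      fun a => Matrix.diagonal fun _ => a := funext fun a => Matrix.scalar_apply a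
  rw [h]
  exact (continuous_pi fun _ => continuous_id).matrix_diagonal

omit [NumberField F] in
/-- `(g_w)_w ↦ (det g_w · 1_N)_w` is continuous (private plumbing for `continuous_localCenter`). [folklore] -/
private theorem continuous_localScalarGL (v : HeightOneSpectrum (𝓞 F)) : Continuous (localScalarGL E N v) := by
  refine continuous_pi fun w => ?_
  exact ((continuous_scalar E N w.1).units_map
    (Matrix.scalar (Fin N) : w.1.adicCompletion E →+* Matrix (Fin N) (Fin N) (w.1.adicCompletion E)).toMonoidHom).comp
    (Matrix.GeneralLinearGroup.continuous_det.comp (continuous_apply w))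

/-- **the local centre `u ↦ u · 1_N : U(J₁)(F_v) → U(J)(F_v)` is continuous.** [cite: Mok2014, §1 Notation p. 5] -/
theorem continuous_localCenter (hJ₁ : J₁ 0 0 ≠ 0) (v : HeightOneSpectrum (𝓞 F)) :
    Continuous (localCenter E c N J J₁ hJ₁ v) :=
  ((continuous_localScalarGL E N v).comp continuous_subtype_val).subtype_mk _

end Continuity


end Literature.NumberTheory.Automorphic.UnitaryGroup

/-! ## §2 Survival of `1_{𝒪_vᴺ}` in the central `χ_{1,v}`-coinvariants at the non-split places -/

namespace Literature.NumberTheory.GelbartRogawski1991.UnitaryDualPair.LocalSplitting.FinLocalSplittings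

variable {F : Type} [Field F] [NumberField F] {E : Type} [Field E] [NumberField E] [Algebra F E]
  [Algebra.IsQuadraticExtension F E] {c : E ≃ₐ[F] E} {N : ℕ} {δ : E} {hcδ : c δ = -δ} {hδ : δ ≠ 0} {d : F}
  {hd : δ * δ = algebraMap F E d} {T : Matrix (Fin N) (Fin N) F} {hT : T.IsSymm}
  {J : Matrix (Fin N) (Fin N) E} {hJ : J = T.map (algebraMap F E)}
  (𝓢 : FinLocalSplittings F E c N hcδ hδ hd T hT hJ) (J₁ : Matrix (Fin 1) (Fin 1) E) (hJ₁ : J₁ 0 0 ≠ 0)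

omit [Algebra.IsQuadraticExtension F E] in
/-- `1_{𝒪_vᴺ} ≠ 0` in `𝒮(F_vᴺ)` (it takes the value `1` at `0`). [folklore] -/
private theorem unitVec_ne_zero (v : HeightOneSpectrum (𝓞 F)) : unitVec F (Fin N) v ≠ 0 := by
  intro h
  have h1 := congrArg (fun Φ : SchwartzBruhat (Fin N → v.adicCompletion F) => (Φ : (Fin N → v.adicCompletion F) → ℂ) 0) h
  simp only [ZeroMemClass.coe_zero, Pi.zero_apply] at h1
  rw [unitVec_apply_of_mem] at h1
  · exact one_ne_zero h1
  · simp [integralBox]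

/-- **Survival of the unramified vector at the NON-SPLIT places.**  For a family `𝓢` of local splittings of
`U(J)(F_v)` and a continuous character `χ₁` of the centre `E¹(𝔸_{F,f})`: for all but finitely many finite places `v`
of `F`, if `v` is non-split in `E` (`c • w = w` for a place `w ∣ v`) then the class of `1_{𝒪_vᴺ}` in the
`χ_{1,v}`-coinvariants of `ω_v ∘ (u ↦ u · 1_N)` — the local factor of [Liu2021, Def. 4.11]'s `⊗'_v ω(μ_v, ε_v, χ_v)` — is
NON-ZERO.  (Off a finite set `U(J)(𝒪_v)` fixes `1_{𝒪_vᴺ}` and `χ_{1,v}` is unramified; at a non-split `v` the whole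
centre `E_v¹` is integral and compact, and an invariant vector of a compact group survives in the coinvariants.)
[cite: Liu2021, Def. 4.11 (l. 2092–2096)] -/
theorem eventually_mk_unitVec_ne_zero_of_nonsplit {χ₁ : finAdelicOne F E c →* ℂˣ} (hχ₁ : Continuous χ₁) :
    ∀ᶠ v : HeightOneSpectrum (𝓞 F) in cofinite, ∀ w : PlacesOver E v, c • w.1 = w.1 →
      TwistedCoinv.mk (show Representation ℂ (localPi E c 1 J₁ v) (SchwartzBruhat (Fin N → v.adicCompletion F)) from
          (𝓢.omegaLoc v).comp (localCenter E c N J J₁ hJ₁ v))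
        (localCharOfCenter F E c J₁ hJ₁ χ₁ v) (unitVec F (Fin N) v) ≠ 0 := by
  -- `c δ = -δ ≠ 0` forces `c ≠ 1`
  have hc : c ≠ 1 := by
    rintro rfl
    exact hδ (self_eq_neg.1 (by simpa only [AlgEquiv.one_apply] using hcδ))
  filter_upwards [𝓢.unramified, eventually_localCharOfCenter_eq_one F E c J₁ hJ₁ hχ₁] with v hunr hχv
  intro w hw
  haveI : CompactSpace (localPi E c 1 J₁ v) := compactSpace_localPi_one_of_smul_eq c J₁ hc hJ₁ w hw
  have hmem : ∀ h : localPi E c 1 J₁ v, h ∈ localInt E c 1 J₁ v := fun h => by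
    rw [localInt_one_eq_top_of_smul_eq c J₁ hc hJ₁ w hw]; exact Subgroup.mem_top h
  refine TwistedCoinv.mk_ne_zero_of_mem_invariants (k := ℂ) _ _ (fun Φ => ?_) (fun h => hχv h (hmem h))
    (unitVec_ne_zero v) (fun h => ?_)
  · -- smoothness of `ω_v ∘ (local centre)`: the stabiliser is the preimage of an open stabiliser
    show IsOpen ((localCenter E c N J J₁ hJ₁ v) ⁻¹' (((𝓢.omegaLoc v).stabilizerSubgroup Φ : Subgroup (localPi E c N J v)) :
      Set (localPi E c N J v)))
    exact (𝓢.isSmooth_omegaLoc v Φ).preimage (continuous_localCenter E c N J J₁ hJ₁ v)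
  · -- `1_{𝒪_vᴺ}` is fixed by the (integral) centre
    show 𝓢.omegaLoc v (localCenter E c N J J₁ hJ₁ v h) (unitVec F (Fin N) v) = unitVec F (Fin N) v
    exact hunr _ (localCenter_mapsTo_localInt E c N J J₁ hJ₁ v (hmem h))

/-- `Finset` form: **there is a finite set `S₀` of places off which, at every non-split place, `[1_{𝒪_vᴺ}] ≠ 0`** in the
central `χ_{1,v}`-coinvariants — the non-split half of the survival clause `hS` of
`Def411WeilCarriers.rho_isIrreducible_of_lemD1AsPrinted_of_factors`. [cite: Liu2021, Def. 4.11 (l. 2092–2096)] -/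
theorem exists_finset_mk_unitVec_ne_zero_of_nonsplit {χ₁ : finAdelicOne F E c →* ℂˣ} (hχ₁ : Continuous χ₁) :
    ∃ S₀ : Finset (HeightOneSpectrum (𝓞 F)), ∀ v : HeightOneSpectrum (𝓞 F), v ∉ S₀ → ∀ w : PlacesOver E v, c • w.1 = w.1 →
      TwistedCoinv.mk (show Representation ℂ (localPi E c 1 J₁ v) (SchwartzBruhat (Fin N → v.adicCompletion F)) from
          (𝓢.omegaLoc v).comp (localCenter E c N J J₁ hJ₁ v))
        (localCharOfCenter F E c J₁ hJ₁ χ₁ v) (unitVec F (Fin N) v) ≠ 0 := by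
  have h := 𝓢.eventually_mk_unitVec_ne_zero_of_nonsplit J₁ hJ₁ hχ₁
  rw [Filter.eventually_cofinite] at h
  refine ⟨h.toFinset, fun v hv => ?_⟩
  have hv' : v ∉ {v | ¬ _} := fun hm => hv (h.mem_toFinset.2 hm)
  simpa only [Set.mem_setOf_eq, not_not] using hv'

end Literature.NumberTheory.GelbartRogawski1991.UnitaryDualPair.LocalSplitting.FinLocalSplittings
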